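import Summits.BirchSwinnertonDyer.BirchSwinnertonDyer.Theorems.PrintCf2SplitBadTwoLocalGroupsBridge
import Literature.NumberTheory.ComplexMultiplication.EllipticUnits.ImaginaryQuadraticMainConjectureCarriers
import Literature.NumberTheory.GaloisRepresentations.RestrictedRamification
import Literature.NumberTheory.GaloisRepresentations.FrobeniusDensityTheorem
import Literature.NumberTheory.NumberFields.UnramifiedCompositum
import HarnessLib

/-!
# M-LINE-PIN / (α3) ROW 2: THE (C-e) TAME CONDUCTOR IDEAL `𝔣_θ′` OF A CHARACTER OF FINITE ORDER — the ideal `𝔣` the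
# `stub_classGroupHalf` assembler must CHOOSE (its statement carries no `𝔣`), with the two frame facts ROW 2 displays about it

Cell `bsd-print-cf2`, WIDTH seat `bsd-line-cf2-p1-w2` g19 (prover-bsd-line-cf2-p1-w2-g19-0); `--supports` stmt-BirchSwinnertonDyer-24721
(helper, Theses-free). HONEST FRAMING: Galois-theoretic bookkeeping; nothing here closes the crux or a registered stub; no summit statement
is proved by this seat; BSD is not proved by any of this. THEOREMS ONLY (no definition, no named fact, no instance, no `sorry`).

WHAT. ROW 2 of the JLK road (-w6 g8–g10, `RowTwo.forall_exists_smul_mem_range(_of_ncard_le)`) runs over `𝒪_K[1/p𝔣]` and displays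
`hNK₀ : ramificationSubgroup K (suppPF p 𝔣) ≤ galFixing K K₀` («`K₀ ⊆ K_S`») and `hram` («`θ′` has a `−1` on inertia at every `𝔩 ∣ 𝔣`,
`𝔩 ∤ p`», reduced to `hram0 : ∀ u ∈ suppPF p 𝔣, p ∉ u → ∃ δ₀ ∈ inertia u, θ′ δ₀ ≠ 1` by -w2 g19 `RowTwoRamified.hram_of_ramified_of_sq`); -w6 g9's
memo (C-e): BOTH hold iff the tame support of `𝔣` is EXACTLY the set of places `u ∤ p` where `θ′` is ramified. For a character
`θ′ : Γ_K → ℤ_pˣ` trivial on `Gal(K̄/K₀)`, `K₀/K` finite Galois (the class line: `K₀ = K_θ`, `θ′ = unitChar θ` quadratic):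

* §1 `finite_setOf_exists_mem_inertia_apply_ne_one` — the places `u` with `θ′|_{I_u} ≠ 1` are finitely many (they ramify in `K₀`:
  `finite_setOf_not_isUnramifiedIn` + `isUnramifiedIn_iff_forall_inertia_absRestrictNormalHom_eq_one`).
* §2 `exists_ideal_dvd_iff_exists_mem_inertia_apply_ne_one` — a non-zero ideal `𝔣₀` prime to `p` with `u ∣ 𝔣₀ ↔ θ′|_{I_u} ≠ 1` for every `u ∤ p`
  (the square-free product of those places); `dvd_mul_iff_dvd_of_forall_mem` — multiplying by an ideal supported above `p` does not change the
  tame support (so `𝔣 = 𝔣₀ · (v v̄)^e` is allowed).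
* §3 for ANY `𝔣` whose tame support contains / is contained in the ramification set: `exists_mem_inertia_apply_ne_one_of_mem_suppPF` (`hram0`) and
  ★ `ramificationSubgroup_suppPF_le_ker` / `ramificationSubgroup_suppPF_le_galFixing` (`hNK₀`; `ramificationSubgroup_le_ker` at ALL primes above `u`
  by conjugation to `𝔓₀`, `Ideal.conj_mem_inertia_smul_iff`).
* §4 `exists_tameConductor` — the package: `∃ 𝔣 ≠ ⊥` prime to `p` with `hNK₀` and `hram0`.

presearch: «conductor of a character of finite order / finitely many ramified primes» → Neukirch VII §10 (10.6), VI (6.6) (held; tree currency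
`finite_setOf_not_isUnramifiedIn`, `isUnramifiedIn_iff_not_conductor_dvd`); JLK 2011 Lemma 4.3 (`S ⊇` ram(χ)); no new fact. beyond-print theorem: no.

References: J. Neukirch, *Algebraic Number Theory* (1999) Ch. VII §10 (10.6), Ch. I §9 (9.4); J. Johnson-Leung, G. Kings, J. reine angew. Math. 653
(2011) §4 Lemma 4.3, Cor. 5.3; J. Neukirch, A. Schmidt, K. Wingberg (2008) VIII §3.
-/

noncomputable section

open scoped Classical Pointwise

-- the summit namespace `Summit.BirchSwinnertonDyer.BirchSwinnertonDyer` repeats the problem name by design (D-0017)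
set_option linter.dupNamespace false
set_option autoImplicit false

open scoped NumberField
open NumberField IsDedekindDomain Field IntermediateField
open Literature.NumberTheory.GaloisRepresentations Literature.NumberTheory.GaloisRepresentations.LocalWeilDatum
  Literature.NumberTheory.EllipticCurves Literature.NumberTheory.EllipticCurves.GreenbergSelmer
  Literature.NumberTheory.ComplexMultiplication.EllipticUnits Literature.NumberTheory.NumberFields
open Summit.BirchSwinnertonDyer.BirchSwinnertonDyer.Theorems.PrintCf2

namespace Summit.BirchSwinnertonDyer.BirchSwinnertonDyer.Theorems.PrintCf2.TameConductor

variable {K : Type} [Field K] [NumberField K] {p : ℕ} [Fact p.Prime]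

/-! ## §1. Finitely many places carry a non-trivial inertia value -/

/-- **The places `u` with `θ′|_{I_u} ≠ 1` are finitely many** when `θ′` kills `Gal(K̄/K₀)` for a finite Galois `K₀ ⊆ K̄`: at such a `u` the
inertia group `I_u = I_{𝔓₀}` does not die in `Gal(K₀/K)`, so `u` is ramified in `K₀` (`isUnramifiedIn_iff_forall_inertia_absRestrictNormalHom_eq_one`),
and only finitely many places ramify (`finite_setOf_not_isUnramifiedIn`). [cite: NeukirchANT1999, Ch. VII §10 Thm. (10.6) (proof)] -/
theorem finite_setOf_exists_mem_inertia_apply_ne_one (θ' : absoluteGaloisGroup K →ₜ* ℤ_[p]ˣ)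
    (K₀ : IntermediateField K (AlgebraicClosure K)) [FiniteDimensional K K₀] [IsGalois K K₀]
    (hθ'K₀ : ∀ σ ∈ galFixing K K₀, θ' σ = 1) :
    {u : HeightOneSpectrum (𝓞 K) | ∃ δ ∈ inertia u, θ' δ ≠ 1}.Finite := by
  haveI : NumberField K₀ := NumberField.of_module_finite K K₀
  refine (finite_setOf_not_isUnramifiedIn K K₀).subset ?_
  rintro u ⟨δ, hδ, hne⟩
  change ¬ Algebra.IsUnramifiedIn (𝓞 K₀) u.asIdeal
  intro hunr
  rw [isUnramifiedIn_iff_forall_inertia_absRestrictNormalHom_eq_one K₀ u] at hunr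
  have hδ' : δ ∈ (adicCompletionPrime K u).inertia (absoluteGaloisGroup K) := by
    rw [inertia_adicCompletionPrime_eq_map_absInertia]
    exact hδ
  have h1 := hunr _ (adicCompletionPrime_mem_primesAbove K u) δ hδ'
  rw [absRestrictNormalHom_eq_one_iff_forall_smul] at h1
  exact hne (hθ'K₀ δ ((mem_galFixing_iff K).mpr fun x hx ↦ h1 ⟨x, hx⟩))

/-! ## §2. The square-free tame conductor support as an ideal -/

/-- Two places dividing one another are equal (non-zero primes of a Dedekind domain are maximal). [folklore] -/
theorem eq_of_asIdeal_dvd {u t : HeightOneSpectrum (𝓞 K)} (h : u.asIdeal ∣ t.asIdeal) : t = u := by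
  apply HeightOneSpectrum.ext
  exact (t.isPrime.isMaximal t.ne_bot).eq_of_le u.isPrime.ne_top (Ideal.dvd_iff_le.mp h)

/-- **The ideal `𝔣₀ = ∏ u` over the places `u ∤ p` with `θ′|_{I_u} ≠ 1`**: non-zero, prime to `p`, and for every `u ∤ p`:
`u ∣ 𝔣₀ ↔ θ′|_{I_u} ≠ 1`. [cite: NeukirchANT1999, Ch. VII §10 Thm. (10.6)] [cite: JohnsonLeungKings2011, §4 Lemma 4.3] -/
theorem exists_ideal_dvd_iff_exists_mem_inertia_apply_ne_one (θ' : absoluteGaloisGroup K →ₜ* ℤ_[p]ˣ)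
    (K₀ : IntermediateField K (AlgebraicClosure K)) [FiniteDimensional K K₀] [IsGalois K K₀]
    (hθ'K₀ : ∀ σ ∈ galFixing K K₀, θ' σ = 1) :
    ∃ 𝔣 : Ideal (𝓞 K), 𝔣 ≠ ⊥ ∧ (∀ u : HeightOneSpectrum (𝓞 K), u.asIdeal ∣ 𝔣 → ((p : ℕ) : 𝓞 K) ∉ u.asIdeal) ∧
      ∀ u : HeightOneSpectrum (𝓞 K), ((p : ℕ) : 𝓞 K) ∉ u.asIdeal → (u.asIdeal ∣ 𝔣 ↔ ∃ δ ∈ inertia u, θ' δ ≠ 1) := by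
  have hfin : {u : HeightOneSpectrum (𝓞 K) | ((p : ℕ) : 𝓞 K) ∉ u.asIdeal ∧ ∃ δ ∈ inertia u, θ' δ ≠ 1}.Finite :=
    (finite_setOf_exists_mem_inertia_apply_ne_one θ' K₀ hθ'K₀).subset fun u hu ↦ hu.2
  set T : Finset (HeightOneSpectrum (𝓞 K)) := hfin.toFinset with hT
  have hmemT : ∀ u : HeightOneSpectrum (𝓞 K), u ∈ T ↔ ((p : ℕ) : 𝓞 K) ∉ u.asIdeal ∧ ∃ δ ∈ inertia u, θ' δ ≠ 1 := fun u ↦ by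
    rw [hT, Set.Finite.mem_toFinset, Set.mem_setOf_eq]
  have hdvd : ∀ u : HeightOneSpectrum (𝓞 K), u.asIdeal ∣ ∏ t ∈ T, t.asIdeal ↔ u ∈ T := fun u ↦ by
    rw [Prime.dvd_finsetProd_iff u.prime]
    constructor
    · rintro ⟨t, ht, hut⟩
      rwa [← eq_of_asIdeal_dvd hut]
    · exact fun hu ↦ ⟨u, hu, dvd_rfl⟩
  refine ⟨∏ t ∈ T, t.asIdeal, ?_, fun u hu ↦ ((hmemT u).mp ((hdvd u).mp hu)).1, fun u hup ↦ ?_⟩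
  · rw [Ne, ← Ideal.zero_eq_bot, Finset.prod_eq_zero_iff]
    rintro ⟨t, -, ht⟩
    exact t.ne_bot (by rwa [Ideal.zero_eq_bot] at ht)
  · rw [hdvd, hmemT]
    exact ⟨fun h ↦ h.2, fun h ↦ ⟨hup, h⟩⟩

omit [Fact p.Prime] in
/-- **Multiplying by an ideal supported above `p` does not change the tame support**: for `u ∤ p` and `𝔤` all of whose prime factors lie above
`p`, `u ∣ 𝔣·𝔤 ↔ u ∣ 𝔣` (so the assembler may take `𝔣 = 𝔣₀·(v v̄)^e`). [folklore] -/
theorem dvd_mul_iff_dvd_of_forall_mem {𝔣 𝔤 : Ideal (𝓞 K)} (h𝔤 : ∀ u : HeightOneSpectrum (𝓞 K), u.asIdeal ∣ 𝔤 → ((p : ℕ) : 𝓞 K) ∈ u.asIdeal)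
    {u : HeightOneSpectrum (𝓞 K)} (hup : ((p : ℕ) : 𝓞 K) ∉ u.asIdeal) : u.asIdeal ∣ 𝔣 * 𝔤 ↔ u.asIdeal ∣ 𝔣 := by
  refine ⟨fun h ↦ ?_, fun h ↦ h.mul_right 𝔤⟩
  rcases u.prime.dvd_or_dvd h with h | h
  · exact h
  · exact absurd (h𝔤 u h) hup

omit [Fact p.Prime] in
/-- Membership in `suppPF p 𝔣` for a place `u ∤ p`: `u ∣ p𝔣 ↔ u ∣ 𝔣`. [cite: JohnsonLeungKings2011, Cor. 5.3 (arXiv p0015:L1–3)] -/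
theorem mem_suppPF_iff_dvd_of_not_mem (𝔣 : Ideal (𝓞 K)) {u : HeightOneSpectrum (𝓞 K)} (hup : ((p : ℕ) : 𝓞 K) ∉ u.asIdeal) :
    u ∈ JohnsonLeungKings2011.suppPF p 𝔣 ↔ u.asIdeal ∣ 𝔣 := by
  change u.asIdeal ∣ Ideal.span {((p : ℕ) : 𝓞 K)} * 𝔣 ↔ _
  refine ⟨fun h ↦ ?_, fun h ↦ h.mul_left _⟩
  rcases u.prime.dvd_or_dvd h with h | h
  · exact absurd (Ideal.dvd_span_singleton.mp h) hup
  · exact h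

omit [Fact p.Prime] in
/-- A place outside `suppPF p 𝔣` is prime to `p` and does not divide `𝔣`. [cite: JohnsonLeungKings2011, Cor. 5.3 (arXiv p0015:L1–3)] -/
theorem not_mem_and_not_dvd_of_not_mem_suppPF (𝔣 : Ideal (𝓞 K)) {u : HeightOneSpectrum (𝓞 K)}
    (hu : u ∉ JohnsonLeungKings2011.suppPF p 𝔣) : ((p : ℕ) : 𝓞 K) ∉ u.asIdeal ∧ ¬ u.asIdeal ∣ 𝔣 := by
  have hu' : ¬ u.asIdeal ∣ Ideal.span {((p : ℕ) : 𝓞 K)} * 𝔣 := hu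
  refine ⟨fun hp ↦ hu' ((Ideal.dvd_span_singleton.mpr hp).mul_right 𝔣), fun h ↦ hu' (h.mul_left _)⟩

/-! ## §3. The two displayed frame facts for any `𝔣` with the right tame support -/

/-- **`hram0`**: if every `u ∤ p` dividing `𝔣` carries a non-trivial inertia value of `θ′`, then so does every `u ∈ suppPF p 𝔣` prime to `p`
(the hypothesis of -w2 g19's `RowTwoRamified.hram_of_ramified_of_sq`). [cite: JohnsonLeungKings2011, §4 Lemma 4.3] -/
theorem exists_mem_inertia_apply_ne_one_of_mem_suppPF (θ' : absoluteGaloisGroup K →ₜ* ℤ_[p]ˣ) {𝔣 : Ideal (𝓞 K)}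
    (h𝔣 : ∀ u : HeightOneSpectrum (𝓞 K), ((p : ℕ) : 𝓞 K) ∉ u.asIdeal → u.asIdeal ∣ 𝔣 → ∃ δ ∈ inertia u, θ' δ ≠ 1) :
    ∀ u ∈ JohnsonLeungKings2011.suppPF p 𝔣, ((p : ℕ) : 𝓞 K) ∉ u.asIdeal → ∃ δ₀ ∈ inertia u, θ' δ₀ ≠ 1 :=
  fun u hu hup ↦ h𝔣 u hup ((mem_suppPF_iff_dvd_of_not_mem 𝔣 hup).mp hu)

/-- **`hNK₀` (kernel form): `N_S ≤ ker θ′` for `S = suppPF p 𝔣`** whenever every `u ∤ p` with `θ′|_{I_u} ≠ 1` divides `𝔣`, `θ′` killing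
`Gal(K̄/K₀)` for a finite `K₀` (so `ker θ′` is open). At a place `w ∉ S` (hence `w ∤ p`, `w ∤ 𝔣`) `θ′` is trivial on `I_w = I_{𝔓₀}`, hence on the
inertia group of EVERY prime `𝔓 = τ𝔓₀` above `w` (`I_{τ𝔓₀} = τ I_{𝔓₀} τ⁻¹`, `ℤ_pˣ` commutative); conclude by `ramificationSubgroup_le_ker`.
[cite: NeukirchSchmidtWingberg2008, VIII §3] [cite: NeukirchANT1999, Ch. I §9 (9.4)] -/
theorem ramificationSubgroup_suppPF_le_ker (θ' : absoluteGaloisGroup K →ₜ* ℤ_[p]ˣ)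
    (K₀ : IntermediateField K (AlgebraicClosure K)) [FiniteDimensional K K₀] (hθ'K₀ : ∀ σ ∈ galFixing K K₀, θ' σ = 1)
    {𝔣 : Ideal (𝓞 K)}
    (h𝔣 : ∀ u : HeightOneSpectrum (𝓞 K), ((p : ℕ) : 𝓞 K) ∉ u.asIdeal → (∃ δ ∈ inertia u, θ' δ ≠ 1) → u.asIdeal ∣ 𝔣) :
    ramificationSubgroup K (JohnsonLeungKings2011.suppPF p 𝔣) ≤ (θ' : absoluteGaloisGroup K →* ℤ_[p]ˣ).ker := by
  -- `ker θ′ ⊇ Gal(K̄/K₀)` is open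
  have hle : galFixing K K₀ ≤ (θ' : absoluteGaloisGroup K →* ℤ_[p]ˣ).ker := fun σ hσ ↦ by
    rw [MonoidHom.mem_ker]
    exact hθ'K₀ σ hσ
  have hopen : IsOpen (((θ' : absoluteGaloisGroup K →* ℤ_[p]ˣ).ker : Subgroup (absoluteGaloisGroup K)) :
      Set (absoluteGaloisGroup K)) :=
    Subgroup.isOpen_mono hle (isOpen_galFixing K K₀)
  refine ramificationSubgroup_le_ker (θ' : absoluteGaloisGroup K →* ℤ_[p]ˣ) hopen fun w hw 𝔓 h𝔓 σ hσ ↦ ?_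
  obtain ⟨hwp, hw𝔣⟩ := not_mem_and_not_dvd_of_not_mem_suppPF (p := p) 𝔣 hw
  -- `θ′` is trivial on `I_w`
  have htriv : ∀ δ ∈ inertia w, θ' δ = 1 := fun δ hδ ↦
    by_contra fun hne ↦ hw𝔣 (h𝔣 w hwp ⟨δ, hδ, hne⟩)
  -- conjugate `𝔓 = τ • 𝔓₀`
  obtain ⟨τ, rfl⟩ := HeightOneSpectrum.exists_smul_eq_of_mem_primesAbove_holds (adicCompletionPrime_mem_primesAbove K w) h𝔓
  have hσ_eq : σ = τ * (τ⁻¹ * σ * τ) * τ⁻¹ := by group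
  have hσ' : τ⁻¹ * σ * τ ∈ (adicCompletionPrime K w).inertia (absoluteGaloisGroup K) := by
    rwa [← Ideal.conj_mem_inertia_smul_iff (adicCompletionPrime K w) τ, ← hσ_eq]
  have hmem : τ⁻¹ * σ * τ ∈ inertia w := by
    change τ⁻¹ * σ * τ ∈ (absInertia (w.adicCompletion K)).map (absGaloisRestrict K (w.adicCompletion K)).toMonoidHom
    rw [← inertia_adicCompletionPrime_eq_map_absInertia]
    exact hσ'
  have h1 : θ' (τ⁻¹ * σ * τ) = 1 := htriv _ hmem
  change θ' σ = 1
  rw [map_mul, map_mul, map_inv, mul_comm (θ' τ)⁻¹, mul_assoc, inv_mul_cancel, mul_one] at h1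
  exact h1

/-- **`hNK₀` VERBATIM (ROW 2's binder): `ramificationSubgroup K (suppPF p 𝔣) ≤ galFixing K K₀`** when moreover `ker θ′ ≤ Gal(K̄/K₀)` (`K₀ = K_θ′`
exactly, -w6 g9's `hG₀`). [cite: NeukirchSchmidtWingberg2008, VIII §3] -/
theorem ramificationSubgroup_suppPF_le_galFixing (θ' : absoluteGaloisGroup K →ₜ* ℤ_[p]ˣ)
    (K₀ : IntermediateField K (AlgebraicClosure K)) [FiniteDimensional K K₀] (hθ'K₀ : ∀ σ ∈ galFixing K K₀, θ' σ = 1)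
    (hG₀ : ∀ σ : absoluteGaloisGroup K, θ' σ = 1 → σ ∈ galFixing K K₀) {𝔣 : Ideal (𝓞 K)}
    (h𝔣 : ∀ u : HeightOneSpectrum (𝓞 K), ((p : ℕ) : 𝓞 K) ∉ u.asIdeal → (∃ δ ∈ inertia u, θ' δ ≠ 1) → u.asIdeal ∣ 𝔣) :
    ramificationSubgroup K (JohnsonLeungKings2011.suppPF p 𝔣) ≤ galFixing K K₀ :=
  fun σ hσ ↦ hG₀ σ (by
    have h := ramificationSubgroup_suppPF_le_ker θ' K₀ hθ'K₀ h𝔣 hσ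
    rwa [MonoidHom.mem_ker] at h)

/-! ## §4. The package -/

/-- **THE (C-e) TAME CONDUCTOR OF `θ′`.** For `θ′ : Γ_K → ℤ_pˣ` killing `Gal(K̄/K₀)`, `K₀/K` finite Galois: there is a non-zero ideal `𝔣` of
`𝓞 K`, prime to `p`, whose prime factors are EXACTLY the places `u ∤ p` with `θ′|_{I_u} ≠ 1`; for it (and for every `𝔣·𝔤`, `𝔤` supported
above `p`) ROW 2's `hNK₀` holds in kernel form and `hram0` holds. [cite: JohnsonLeungKings2011, §4 Lemma 4.3, Cor. 5.3]
[cite: NeukirchANT1999, Ch. VII §10 Thm. (10.6)] -/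
theorem exists_tameConductor (θ' : absoluteGaloisGroup K →ₜ* ℤ_[p]ˣ)
    (K₀ : IntermediateField K (AlgebraicClosure K)) [FiniteDimensional K K₀] [IsGalois K K₀]
    (hθ'K₀ : ∀ σ ∈ galFixing K K₀, θ' σ = 1) :
    ∃ 𝔣 : Ideal (𝓞 K), 𝔣 ≠ ⊥ ∧ (∀ u : HeightOneSpectrum (𝓞 K), u.asIdeal ∣ 𝔣 → ((p : ℕ) : 𝓞 K) ∉ u.asIdeal) ∧
      (∀ u : HeightOneSpectrum (𝓞 K), ((p : ℕ) : 𝓞 K) ∉ u.asIdeal → (u.asIdeal ∣ 𝔣 ↔ ∃ δ ∈ inertia u, θ' δ ≠ 1)) ∧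
      ramificationSubgroup K (JohnsonLeungKings2011.suppPF p 𝔣) ≤ (θ' : absoluteGaloisGroup K →* ℤ_[p]ˣ).ker ∧
      (∀ u ∈ JohnsonLeungKings2011.suppPF p 𝔣, ((p : ℕ) : 𝓞 K) ∉ u.asIdeal → ∃ δ₀ ∈ inertia u, θ' δ₀ ≠ 1) := by
  obtain ⟨𝔣, h0, hp, hiff⟩ := exists_ideal_dvd_iff_exists_mem_inertia_apply_ne_one θ' K₀ hθ'K₀
  exact ⟨𝔣, h0, hp, hiff,
    ramificationSubgroup_suppPF_le_ker θ' K₀ hθ'K₀ fun u hu h ↦ (hiff u hu).mpr h,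
    exists_mem_inertia_apply_ne_one_of_mem_suppPF θ' fun u hu h ↦ (hiff u hu).mp h⟩

/-- The same package with `hNK₀` in ROW 2's VERBATIM form `≤ galFixing K K₀` (when `ker θ′ = Gal(K̄/K₀)`), and with `hram0` upgraded to the value
`−1` for a `{±1}`-valued `θ′` (the input of `RowTwoRamified.hram_of_inertia`). [cite: JohnsonLeungKings2011, §4 Lemma 4.3, Cor. 5.3] -/
theorem exists_tameConductor_of_sq (θ' : absoluteGaloisGroup K →ₜ* ℤ_[p]ˣ)
    (K₀ : IntermediateField K (AlgebraicClosure K)) [FiniteDimensional K K₀] [IsGalois K K₀]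
    (hθ'K₀ : ∀ σ ∈ galFixing K K₀, θ' σ = 1) (hG₀ : ∀ σ : absoluteGaloisGroup K, θ' σ = 1 → σ ∈ galFixing K K₀)
    (hθ'2 : ∀ σ : absoluteGaloisGroup K, θ' σ = 1 ∨ θ' σ = -1) :
    ∃ 𝔣 : Ideal (𝓞 K), 𝔣 ≠ ⊥ ∧ (∀ u : HeightOneSpectrum (𝓞 K), u.asIdeal ∣ 𝔣 → ((p : ℕ) : 𝓞 K) ∉ u.asIdeal) ∧
      (∀ u : HeightOneSpectrum (𝓞 K), ((p : ℕ) : 𝓞 K) ∉ u.asIdeal → (u.asIdeal ∣ 𝔣 ↔ ∃ δ ∈ inertia u, θ' δ ≠ 1)) ∧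
      ramificationSubgroup K (JohnsonLeungKings2011.suppPF p 𝔣) ≤ galFixing K K₀ ∧
      (∀ u ∈ JohnsonLeungKings2011.suppPF p 𝔣, ((p : ℕ) : 𝓞 K) ∉ u.asIdeal → ∃ δ₀ ∈ inertia u, θ' δ₀ = -1) := by
  obtain ⟨𝔣, h0, hp, hiff, -, hram0⟩ := exists_tameConductor θ' K₀ hθ'K₀
  refine ⟨𝔣, h0, hp, hiff, ramificationSubgroup_suppPF_le_galFixing θ' K₀ hθ'K₀ hG₀ fun u hu h ↦ (hiff u hu).mpr h, fun u hu hup ↦ ?_⟩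
  obtain ⟨δ₀, hδ₀, hne⟩ := hram0 u hu hup
  exact ⟨δ₀, hδ₀, (hθ'2 δ₀).resolve_left hne⟩

end Summit.BirchSwinnertonDyer.BirchSwinnertonDyer.Theorems.PrintCf2.TameConductor

end
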